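import Summits.QuantumFields.QCD.Theses.SpectralDefectExtinction
import Literature.MathematicalPhysics.QuantumLattice.OverlapLocality

/-!
# Stub `stub_positivity` of line `positivity-no-leak-spread`
(crux `Summit.QuantumFields.QCD.Theses.SpectralDefectExtinction.TipNoBinding`, item stmt-QuantumFields-8965)

**Wilson positivity** for the massless `r = 1` Wilson–Dirac operator
`D = wilsonDirac (fundamentalRep (Fin 3)) U 0 1` on the four-torus `(ℤ/L)⁴` with an arbitrary `SU(3)`
link field `U` and every spinor `ψ`:

  `Re⟨ψ, Dψ⟩ = ½ Σ_{x,μ,a,α} |Σ_b U(x,μ)_{ab} ψ(x+μ̂)_{bα} − ψ(x)_{aα}|²`.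

Proof (operator route).  By `wilsonDirac_eq_sub_sum_wilsonHop`, `D = 4·1 − Σ_μ W_μ` with
`W_μ = F_μ ⊗ P⁻_μ + F_μᴴ ⊗ P⁺_μ` (reindexed to site × colour × spin), `F_μ = linkHop ρ U μ` the unitary
`U`-twisted forward shift (`conjTranspose_mul_linkHop`) and `P^∓_μ = ½(1 ∓ γ_μ)` Hermitian with
`P⁻_μ + P⁺_μ = 1`.  Since `Re⟨ψ, Aᴴψ⟩ = Re⟨ψ, Aψ⟩`, `Re⟨ψ, W_μψ⟩ = Re⟨ψ, (F_μ ⊗ 1)ψ⟩`, so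
`Re⟨ψ, Dψ⟩ = 4‖ψ‖² − Σ_μ Re⟨ψ, (F_μ ⊗ 1)ψ⟩`; and `‖(F_μ ⊗ 1)ψ − ψ‖² = 2‖ψ‖² − 2 Re⟨ψ, (F_μ ⊗ 1)ψ⟩`
because `F_μ ⊗ 1` is an isometry, while `((F_μ ⊗ 1)ψ)(x,a,α) = Σ_b U(x,μ)_{ab} ψ(x+μ̂,b,α)` entrywise.
No named facts are used; everything leaned on is proved in `OverlapLocality.lean` / `GaugeGroups.lean`.
-/

namespace Summit.QuantumFields.QCD.Cruxes.TipNoBinding.PositivityNoLeakSpread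

open Literature.MathematicalPhysics Literature.MathematicalPhysics.QuantumLattice
  Literature.MathematicalPhysics.QuantumFieldTheory Literature.Probability.LatticeModels
open Matrix

/-- `Re⟨v, Aᴴ v⟩ = Re⟨v, A v⟩` for a complex square matrix `A`. -/
private theorem positivity_re_conjTranspose_mulVec {n : Type*} [Fintype n]
    (A : Matrix n n ℂ) (v : n → ℂ) :
    (star v ⬝ᵥ Aᴴ *ᵥ v).re = (star v ⬝ᵥ A *ᵥ v).re := by
  rw [mulVec_conjTranspose, star_dotProduct_star, ← dotProduct_mulVec, Complex.star_def,
    Complex.conj_re]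

/-- `Re⟨v, v⟩ = Σ_i ‖v i‖²`. -/
private theorem positivity_re_star_dotProduct_self {n : Type*} [Fintype n] (v : n → ℂ) :
    (star v ⬝ᵥ v).re = ∑ i, ‖v i‖ ^ 2 := by
  rw [dotProduct, Complex.re_sum]
  refine Finset.sum_congr rfl fun i _ => ?_
  rw [Pi.star_apply, Complex.star_def, ← Complex.normSq_eq_conj_mul_self, Complex.ofReal_re,
    Complex.normSq_eq_norm_sq]

/-- For an isometry `A` (`AᴴA = 1`): `‖A v − v‖² = 2‖v‖² − 2 Re⟨v, A v⟩`. -/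
private theorem positivity_sum_norm_sq_mulVec_sub_self {n : Type*} [Fintype n] [DecidableEq n]
    (A : Matrix n n ℂ) (hA : Aᴴ * A = 1) (v : n → ℂ) :
    ∑ i, ‖(A *ᵥ v - v) i‖ ^ 2 = 2 * ∑ i, ‖v i‖ ^ 2 - 2 * (star v ⬝ᵥ A *ᵥ v).re := by
  rw [← positivity_re_star_dotProduct_self, ← positivity_re_star_dotProduct_self, star_sub,
    sub_dotProduct, dotProduct_sub, dotProduct_sub, star_mulVec, ← dotProduct_mulVec, mulVec_mulVec,
    hA, one_mulVec, Complex.sub_re, Complex.sub_re, Complex.sub_re]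
  have : (star v ᵥ* Aᴴ ⬝ᵥ v).re = (star v ⬝ᵥ A *ᵥ v).re := by
    rw [← star_mulVec, star_dotProduct, Complex.star_def, Complex.conj_re]
  rw [this]
  ring

/-- Entrywise action of `F_μ ⊗ 1_spin` on a spinor, in (site × colour) × spin coordinates:
`((F_μ ⊗ 1)ψ)((x,a),α) = Σ_b U(x,μ)_{ab} ψ(x+μ̂,b,α)`. -/
private theorem positivity_linkHop_kronecker_one_mulVec {L : ℕ} [NeZero L]
    (U : GaugeConfig 4 L ↥(Matrix.specialUnitaryGroup (Fin 3) ℂ)) (μ : Fin 4)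
    (ψ : TorusSite 4 L × Fin 3 × Fin 4 → ℂ) (x : TorusSite 4 L) (a : Fin 3) (α : Fin 4) :
    (kroneckerMap (· * ·) (linkHop (fundamentalRep (Fin 3)) U μ) (1 : Matrix (Fin 4) (Fin 4) ℂ) *ᵥ
        (ψ ∘ Equiv.prodAssoc (TorusSite 4 L) (Fin 3) (Fin 4))) ((x, a), α) =
      ∑ b, (U (x, μ) : Matrix (Fin 3) (Fin 3) ℂ) a b * ψ (Site.shift x μ, b, α) := by
  rw [mulVec, dotProduct, Fintype.sum_prod_type, Fintype.sum_prod_type,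
    Finset.sum_eq_single_of_mem (Site.shift x μ) (Finset.mem_univ _)]
  · refine Finset.sum_congr rfl fun b _ => ?_
    simp only [kroneckerMap_apply, linkHop, of_apply, if_true, fundamentalRep_apply,
      Function.comp_apply, Equiv.prodAssoc_apply, one_apply, mul_ite, mul_one, mul_zero, ite_mul,
      zero_mul, Finset.sum_ite_eq, Finset.mem_univ, if_true]
  · intro y _ hy
    simp only [kroneckerMap_apply, linkHop, of_apply, if_neg hy, zero_mul, Finset.sum_const_zero]

/-- **Wilson positivity** (registered stub `stub_positivity` of line `positivity-no-leak-spread`):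
for every `L ≥ 1`, every `SU(3)` link field `U` on `(ℤ/L)⁴` and every spinor `ψ`,
`Re⟨ψ, D_W(U,0,1)ψ⟩ = ½ Σ_{x,μ,a,α} |Σ_b U(x,μ)_{ab} ψ(x+μ̂)_{bα} − ψ(x)_{aα}|²`, i.e.
`D + Dᴴ = Σ_μ (∇_μ^U)ᴴ ∇_μ^U ⊗ 1_spin` — the `γ_μ` parts of the two hopping terms cancel in the Hermitian
part and the `r = 1` parts complete the square. -/
theorem stub_positivity :
    ∀ (L : ℕ) [NeZero L] (U : GaugeConfig 4 L ↥(Matrix.specialUnitaryGroup (Fin 3) ℂ))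
      (ψ : TorusSite 4 L × Fin 3 × Fin 4 → ℂ),
      (star ψ ⬝ᵥ (wilsonDirac (fundamentalRep (Fin 3)) U 0 1 *ᵥ ψ)).re =
        (1 / 2) * ∑ x, ∑ μ, ∑ a, ∑ α,
          ‖(∑ b, (U (x, μ) : Matrix (Fin 3) (Fin 3) ℂ) a b *
              ψ (QuantumFieldTheory.Site.shift x μ, b, α)) - ψ (x, a, α)‖ ^ 2 := by
  intro L _ U ψ
  have hρ : ∀ g, fundamentalRep (Fin 3) g ∈ Matrix.unitaryGroup (Fin 3) ℂ :=
    fundamentalRep_mem_unitaryGroup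
  set ρ := fundamentalRep (Fin 3)
  set e := Equiv.prodAssoc (TorusSite 4 L) (Fin 3) (Fin 4)
  set ψ' : (TorusSite 4 L × Fin 3) × Fin 4 → ℂ := ψ ∘ e
  set F : Fin 4 → Matrix ((TorusSite 4 L × Fin 3) × Fin 4) ((TorusSite 4 L × Fin 3) × Fin 4) ℂ :=
    fun μ => kroneckerMap (· * ·) (linkHop ρ U μ) (1 : Matrix (Fin 4) (Fin 4) ℂ) with hF
  -- `F_μ ⊗ 1` is an isometry
  have hFF : ∀ μ, (F μ)ᴴ * F μ = 1 := by
    intro μ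
    simp only [hF]
    rw [conjTranspose_kronecker, conjTranspose_one, ← mul_kronecker_mul,
      conjTranspose_mul_linkHop ρ hρ U μ, one_mul, one_kronecker_one]
  -- the hopping term in direction `μ`: `Re⟨ψ, W_μ ψ⟩ = Re⟨ψ', (F_μ ⊗ 1) ψ'⟩`
  have hW : ∀ μ, (star ψ ⬝ᵥ wilsonHop ρ U μ *ᵥ ψ).re = (star ψ' ⬝ᵥ F μ *ᵥ ψ').re := by
    intro μ
    have h2 : kroneckerMap (· * ·) (linkHop ρ U μ)ᴴ (chiralProjPlus μ) =
        (kroneckerMap (· * ·) (linkHop ρ U μ) (chiralProjPlus μ))ᴴ := by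
      rw [conjTranspose_kronecker, chiralProjPlus_conjTranspose]
    rw [wilsonHop, reindex_apply, submatrix_mulVec_equiv, Equiv.symm_symm,
      dotProduct_comp_equiv_symm]
    change (star ψ' ⬝ᵥ _ *ᵥ ψ').re = _
    rw [add_mulVec, dotProduct_add, Complex.add_re, h2, positivity_re_conjTranspose_mulVec,
      ← Complex.add_re, ← dotProduct_add, ← add_mulVec, ← kronecker_add,
      chiralProjMinus_add_chiralProjPlus]
  -- the left-hand side: `Re⟨ψ, Dψ⟩ = 4‖ψ‖² − Σ_μ Re⟨ψ', (F_μ ⊗ 1) ψ'⟩`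
  have hL : (star ψ ⬝ᵥ (wilsonDirac ρ U 0 1 *ᵥ ψ)).re =
      4 * ∑ i, ‖ψ' i‖ ^ 2 - ∑ μ, (star ψ' ⬝ᵥ F μ *ᵥ ψ').re := by
    rw [wilsonDirac_eq_sub_sum_wilsonHop ρ hρ U 0, sub_mulVec, smul_mulVec, one_mulVec,
      sum_mulVec, dotProduct_sub, dotProduct_smul, dotProduct_sum, Complex.sub_re, smul_eq_mul,
      Complex.re_ofReal_mul, Complex.re_sum, positivity_re_star_dotProduct_self,
      Fintype.sum_equiv e (fun j => ‖ψ' j‖ ^ 2) (fun i => ‖ψ i‖ ^ 2) (fun _ => rfl)]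
    simp only [hW]
    ring
  -- the right-hand side, direction by direction: `‖(F_μ ⊗ 1)ψ' − ψ'‖² = 2‖ψ‖² − 2 Re⟨ψ', (F_μ ⊗ 1)ψ'⟩`
  have hR : ∀ μ, ∑ x, ∑ a, ∑ α, ‖(∑ b, (U (x, μ) : Matrix (Fin 3) (Fin 3) ℂ) a b *
      ψ (Site.shift x μ, b, α)) - ψ (x, a, α)‖ ^ 2 =
        2 * ∑ i, ‖ψ' i‖ ^ 2 - 2 * (star ψ' ⬝ᵥ F μ *ᵥ ψ').re := by
    intro μ
    rw [← positivity_sum_norm_sq_mulVec_sub_self (F μ) (hFF μ) ψ', Fintype.sum_prod_type,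
      Fintype.sum_prod_type]
    refine Finset.sum_congr rfl fun x _ => Finset.sum_congr rfl fun a _ =>
      Finset.sum_congr rfl fun α _ => ?_
    rw [Pi.sub_apply, positivity_linkHop_kronecker_one_mulVec]
    rfl
  rw [hL, Finset.sum_comm]
  simp only [hR]
  rw [Finset.sum_sub_distrib, Finset.sum_const, Finset.card_univ, Fintype.card_fin, ← Finset.mul_sum,
    nsmul_eq_mul]
  push_cast
  ring

end Summit.QuantumFields.QCD.Cruxes.TipNoBinding.PositivityNoLeakSpread
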